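/-
Copyright (c) 2026 the pub-hodgecm-mathlib formalisation cell (harness21).  Prover seat hodgecm-mathlib-F0P3a-p07 (g13), 2026-09-02.  Road «S3-ram» seeding wave (LEAD T11-41∕T11-60; owner F0P3a-p06 (g15));
(α₂) organ A₂ (d-ii-a) «TUBE CRITERION» for the type-(2) G-side (architect A-p12 (g23), deal 2026-09-01T23:28:22Z; design memo `DESIGN-A2d-TypeTwoGSide.v1` §1 (TC)).
-/
import Literature.NumberTheory.Automorphic.UnitaryLatticeTreeBlockLineStableRoot   -- ★ p847252 (this seat): `mulVec_single_of_col_eq`, `mulVec_apply_eq_zero_of_row_eq` (block bookkeeping), the (d-i) root splitting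
import HarnessLib

/-!
# The lattice graph of a hermitian space — a BLOCK endomorphism `S = S_W ⊕ u` stabilises a lattice `M` iff `(S_W − u)·pr_W(M) ⊆ M` (the TUBE CRITERION of the type-(2) fixed set)
# (Kottwitz 1986 §3; Rogawski 1990 §4.9–§4.10; Bruhat–Tits 1972 §10)

Topic `NumberTheory/Automorphic`; namespace `Literature.NumberTheory.Automorphic.UnitaryLatticeTree`.  THEOREMS ONLY (no definition, no instance, no notation, no named fact,
no `sorry`); kernel lane `--supports stmt-HodgeConjecture-24833`; datum-free (`K` with `Valued K ℤᵐ⁰`).  Cell `pub/hodgecm-mathlib`, crux H413 = `stmt-HodgeConjecture-24833`;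
road «S3-ram» (count-neutral), (α₂) P-2-ram (architect A-p12 (g23)) organ A₂ (d) «type-(2) G-side counts», part **(d-ii-a)**; design memo
`F0/P3a/F0P3a-p07/g13/type2G/DESIGN-A2d-TypeTwoGSide.v1.F0P3ap07g13.md` §1 (TC).  Seat F0P3a-p07 (g13).  HONEST LABEL: HC_CM is proved only modulo the cell's 2 remaining
named inputs (hLiu418 24832, h413 24833) until rung 0 closes; nothing printed is asserted here (elementary lattice algebra over a valuation ring).

THE MATHEMATICS.  `V = K³ ⊇ W_i = {x : x_i = 0}`, `pr(x) := x − x_i e_i` the projection onto `W_i` along `e_i`.  Let `S` be BLOCK at `i`: the `i`-th column is `u·e_i`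
(`S e_i = u e_i`, `u = S_{ii}`) and the `i`-th row vanishes off the diagonal (`S(W_i) ⊆ W_i`) — the shape of a type-(2) element `γ = γ_W ⊕ u` (and of `γ⁻¹`, and of
`π^{−d}(γ − 1)`) in a frame adapted to the line.  Then `pr ∘ S = S ∘ pr` and, for every `x`,  **`S x = (S − u)·pr(x) + u·x`**.  Consequently, for an `𝒪`-submodule `M ⊆ K³`
and INTEGRAL `u` (`|u| ≤ 1`):
  **(TC)  `S·M ⊆ M  ⟺  ∀ x ∈ M, (S − u)·pr(x) ∈ M`,**
and the witnesses `(S − u)·pr(x)` lie in `W_i`, i.e. in `B_M := M ∩ W_i` — «`γ` fixes `M` iff `(γ_W − u)` maps `pr_W(M)` into `M ∩ W`» (memo §1: for an elliptic `γ_W` with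
eigenvalues `λ, λ′` of the unramified quadratic extension, `|λ − u| = |λ′ − u| = q^{−v}`, this makes the fixed set the tube of radius `v` (in the cotype of `pr_W M ∕ M ∩ W`,
measured through the order `𝒪[γ_W]`) around the split lattices `B ⊕ 𝒪e_i` — the CERT P2ram normaliser `D = |det(u − γ_W)|^{½} = q^{−v}`).  Also recorded: stability of
`B_M` and of `pr_W(M)` under `S` follows from `S·M ⊆ M` (no extra hypothesis).
* §1 `mulVec_sub_single_of_block` (`S·pr(x) = S x − (u x_i) e_i`), `mulVec_apply_self_of_row_eq` (`(Sx)_i = u x_i`), `sub_single_mulVec_of_block` (`pr(Sx) = S·pr(x)`),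
  `mulVec_eq_sub_smul_proj_add_smul` (`S x = (S·pr x − u·pr x) + u·x`);
* §2 (TC) `sub_smul_mulVec_proj_mem_of_forall_mulVec_mem` (⇒, with `(…)_i = 0`), `mulVec_mem_of_forall_sub_smul_mulVec_proj_mem` (⇐),
  `forall_mulVec_mem_iff_forall_sub_smul_mulVec_proj_mem` (⟺); §3 `mulVec_mem_inf_of_forall_mulVec_mem` (`B_M` stable), `mulVec_proj_mem_map_of_forall_mulVec_mem` (`pr_W M` stable);
  §4 (ED. 2) (TC′) `forall_mulVec_mem_iff_sub_smul_mulVec_proj_mem_of_generator` — the ONE-GENERATOR test («`S` acts on the cyclic quotient by a scalar», ref5 R-295).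

## References
* [Kottwitz1986] R. E. Kottwitz, *Base change for unit elements of Hecke algebras*, Compositio Math. 60 (1986), §3 (fixed lattices as modules over `𝒪[γ]`; reduction to Levi blocks).
* [Rogawski1990] J. D. Rogawski, *Automorphic Representations of Unitary Groups in Three Variables*, Ann. of Math. Stud. 123 (1990), §4.9–§4.10 pp. 54–60.
* [BruhatTits1972] F. Bruhat, J. Tits, *Groupes réductifs sur un corps local I*, Publ. Math. IHÉS 41 (1972), §10.
-/

set_option autoImplicit false

noncomputable section

open scoped Valued WithZero Matrix MatrixGroups

namespace Literature.NumberTheory.Automorphic.UnitaryLatticeTree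

open Literature.NumberTheory.Automorphic Literature.NumberTheory.Automorphic.HermitianLattice

variable {K : Type*} [Field K] [Valued K ℤᵐ⁰]

/-! ## §1 Block bookkeeping: `pr ∘ S = S ∘ pr`, `S x = (S − u)·pr(x) + u·x` -/

omit [Valued K ℤᵐ⁰] in
/-- `S·pr(x) = S x − (S_{ii} x_i)·e_i` when the `i`-th column of `S` is `S_{ii}·e_i`. [cite: BruhatTits1972, §10] -/
theorem mulVec_sub_single_of_block {N : ℕ} (S : Matrix (Fin N) (Fin N) K) (i : Fin N) (hcol : ∀ l, l ≠ i → S l i = 0) (x : Fin N → K) :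
    S *ᵥ (x - Pi.single i (x i)) = S *ᵥ x - Pi.single i (S i i * x i) := by
  rw [Matrix.mulVec_sub, mulVec_single_of_col_eq S i hcol]

omit [Valued K ℤᵐ⁰] in
/-- `(S x)_i = S_{ii}·x_i` when the `i`-th row of `S` vanishes off the diagonal. [cite: BruhatTits1972, §10] -/
theorem mulVec_apply_self_of_row_eq {N : ℕ} (S : Matrix (Fin N) (Fin N) K) (i : Fin N) (hrow : ∀ l, l ≠ i → S i l = 0) (x : Fin N → K) :
    (S *ᵥ x) i = S i i * x i := by
  rw [Matrix.mulVec, dotProduct, Finset.sum_eq_single i]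
  · intro l _ hl; rw [hrow l hl, zero_mul]
  · intro hi; exact absurd (Finset.mem_univ i) hi

omit [Valued K ℤᵐ⁰] in
/-- **`pr(S x) = S·pr(x)`** for `S` BLOCK at `i` (column `i` = `S_{ii}e_i`, row `i` zero off the diagonal). [cite: BruhatTits1972, §10] -/
theorem sub_single_mulVec_of_block {N : ℕ} (S : Matrix (Fin N) (Fin N) K) (i : Fin N) (hcol : ∀ l, l ≠ i → S l i = 0) (hrow : ∀ l, l ≠ i → S i l = 0) (x : Fin N → K) :
    S *ᵥ x - Pi.single i ((S *ᵥ x) i) = S *ᵥ (x - Pi.single i (x i)) := by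
  rw [mulVec_sub_single_of_block S i hcol, mulVec_apply_self_of_row_eq S i hrow]

omit [Valued K ℤᵐ⁰] in
/-- **`S x = (S·pr(x) − S_{ii}·pr(x)) + S_{ii}·x`** for `S` with `i`-th column `S_{ii}·e_i` — the decomposition behind the tube criterion. [cite: Kottwitz1986, §3] -/
theorem mulVec_eq_sub_smul_proj_add_smul {N : ℕ} (S : Matrix (Fin N) (Fin N) K) (i : Fin N) (hcol : ∀ l, l ≠ i → S l i = 0) (x : Fin N → K) :
    S *ᵥ x = (S *ᵥ (x - Pi.single i (x i)) - S i i • (x - Pi.single i (x i))) + S i i • x := by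
  rw [mulVec_sub_single_of_block S i hcol, smul_sub, ← Pi.single_smul', smul_eq_mul]
  abel

/-! ## §2 (TC) THE TUBE CRITERION: `S·M ⊆ M ⟺ (S − u)·pr(M) ⊆ M` -/

/-- **(TC ⇒)**: if `S·M ⊆ M` (`S` with `i`-th column `S_{ii}e_i`, `|S_{ii}| ≤ 1`, row `i` zero off the diagonal) then for every `x ∈ M` the vector `(S − S_{ii})·pr(x)` lies in `M`
and in `W_i` — i.e. in `B_M = M ∩ W_i`. [cite: Kottwitz1986, §3] [cite: Rogawski1990, §4.9 p. 55] -/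
theorem sub_smul_mulVec_proj_mem_of_forall_mulVec_mem {S : Matrix (Fin 3) (Fin 3) K} (i : Fin 3)
    (hcol : ∀ l, l ≠ i → S l i = 0) (hrow : ∀ l, l ≠ i → S i l = 0) (hu : Valued.v (S i i) ≤ 1)
    {M : Submodule 𝒪[K] (Fin 3 → K)} (hSM : ∀ x ∈ M, S *ᵥ x ∈ M) {x : Fin 3 → K} (hx : x ∈ M) :
    S *ᵥ (x - Pi.single i (x i)) - S i i • (x - Pi.single i (x i)) ∈ M ∧
      (S *ᵥ (x - Pi.single i (x i)) - S i i • (x - Pi.single i (x i)) : Fin 3 → K) i = 0 := by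
  constructor
  · -- `(S − u)·pr(x) = S x − u·x`
    have hux : S i i • x ∈ M := M.smul_mem (⟨S i i, (mem_integer_iff' _).2 hu⟩ : 𝒪[K]) hx
    have hre : S *ᵥ (x - Pi.single i (x i)) - S i i • (x - Pi.single i (x i)) = S *ᵥ x - S i i • x := by
      have h := mulVec_eq_sub_smul_proj_add_smul S i hcol x
      rw [h]; abel
    rw [hre]
    exact M.sub_mem (hSM x hx) hux
  · have hwi : (x - Pi.single i (x i) : Fin 3 → K) i = 0 := by simp
    rw [Pi.sub_apply, mulVec_apply_eq_zero_of_row_eq S i hrow hwi, Pi.smul_apply, hwi, smul_zero, sub_zero]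

/-- **(TC ⇐)**: if `(S − S_{ii})·pr(x) ∈ M` for every `x ∈ M` (`S` with `i`-th column `S_{ii}e_i`, `|S_{ii}| ≤ 1`) then `S·M ⊆ M` — `S x = (S − u)·pr(x) + u·x`.
[cite: Kottwitz1986, §3] [cite: Rogawski1990, §4.9 p. 55] -/
theorem mulVec_mem_of_forall_sub_smul_mulVec_proj_mem {S : Matrix (Fin 3) (Fin 3) K} (i : Fin 3)
    (hcol : ∀ l, l ≠ i → S l i = 0) (hu : Valued.v (S i i) ≤ 1)
    {M : Submodule 𝒪[K] (Fin 3 → K)} (h : ∀ x ∈ M, S *ᵥ (x - Pi.single i (x i)) - S i i • (x - Pi.single i (x i)) ∈ M) {x : Fin 3 → K} (hx : x ∈ M) :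
    S *ᵥ x ∈ M := by
  rw [mulVec_eq_sub_smul_proj_add_smul S i hcol x]
  exact M.add_mem (h x hx) (M.smul_mem (⟨S i i, (mem_integer_iff' _).2 hu⟩ : 𝒪[K]) hx)

/-- **(TC) THE TUBE CRITERION**: for `S` BLOCK at `i` (`i`-th column `S_{ii}e_i`, `i`-th row zero off the diagonal, `|S_{ii}| ≤ 1`) and an `𝒪`-submodule `M ⊆ K³`:
`S·M ⊆ M ⟺ ∀ x ∈ M, (S − S_{ii})·pr(x) ∈ M` — «`γ = γ_W ⊕ u` fixes `M` iff `(γ_W − u)·pr_W(M) ⊆ M ∩ W`» (apply to `γ` and `γ⁻¹` for `γM = M`).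
[cite: Kottwitz1986, §3] [cite: Rogawski1990, §4.9–§4.10 pp. 55–60] [cite: BruhatTits1972, §10] -/
theorem forall_mulVec_mem_iff_forall_sub_smul_mulVec_proj_mem {S : Matrix (Fin 3) (Fin 3) K} (i : Fin 3)
    (hcol : ∀ l, l ≠ i → S l i = 0) (hrow : ∀ l, l ≠ i → S i l = 0) (hu : Valued.v (S i i) ≤ 1) (M : Submodule 𝒪[K] (Fin 3 → K)) :
    (∀ x ∈ M, S *ᵥ x ∈ M) ↔ ∀ x ∈ M, S *ᵥ (x - Pi.single i (x i)) - S i i • (x - Pi.single i (x i)) ∈ M :=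
  ⟨fun hSM _ hx => (sub_smul_mulVec_proj_mem_of_forall_mulVec_mem i hcol hrow hu hSM hx).1,
    fun h _ hx => mulVec_mem_of_forall_sub_smul_mulVec_proj_mem i hcol hu h hx⟩

/-! ## §3 `B_M = M ∩ W_i` and `pr_W(M)` are `S`-stable as soon as `M` is -/

/-- `S` preserves `W_i`: `x_i = 0 ⇒ (S x)_i = 0` (row condition; restated from ★ p847252 for the consumer's convenience). [cite: BruhatTits1972, §10] -/
theorem mulVec_mem_inf_of_forall_mulVec_mem {S : Matrix (Fin 3) (Fin 3) K} (i : Fin 3) (hrow : ∀ l, l ≠ i → S i l = 0)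
    {M : Submodule 𝒪[K] (Fin 3 → K)} (hSM : ∀ x ∈ M, S *ᵥ x ∈ M) {x : Fin 3 → K} (hx : x ∈ M) (hxi : x i = 0) :
    S *ᵥ x ∈ M ∧ (S *ᵥ x) i = 0 :=
  ⟨hSM x hx, mulVec_apply_eq_zero_of_row_eq S i hrow hxi⟩

/-- `pr_W(M)` is `S`-stable: `S·pr(x) = pr(S x)` is again the projection of an element of `M`. [cite: BruhatTits1972, §10] -/
theorem mulVec_proj_mem_map_of_forall_mulVec_mem {S : Matrix (Fin 3) (Fin 3) K} (i : Fin 3) (hcol : ∀ l, l ≠ i → S l i = 0) (hrow : ∀ l, l ≠ i → S i l = 0)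
    {M : Submodule 𝒪[K] (Fin 3 → K)} (hSM : ∀ x ∈ M, S *ᵥ x ∈ M) {x : Fin 3 → K} (hx : x ∈ M) :
    ∃ y ∈ M, S *ᵥ (x - Pi.single i (x i)) = y - Pi.single i (y i) :=
  ⟨S *ᵥ x, hSM x hx, (sub_single_mulVec_of_block S i hcol hrow x).symm⟩

/-! ## §4 (ED. 2) (TC′) THE ONE-GENERATOR TEST: `S` acts on the cyclic quotient `pr_W M ∕ (M ∩ W)` by a scalar -/

/-- **(TC′) ONE-GENERATOR TUBE TEST** (ref5 (g4) R-295's scalar-on-the-cyclic-quotient reading): let `S` be block at `i` (column `i` = `S_{ii}e_i`, row `i` zero off the diagonal,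
`|S_{ii}| ≤ 1`) and `M` an `𝒪`-submodule whose projection `pr_W(M)` is generated by ONE vector `pr(x₀)` (`x₀ ∈ M`) modulo the W-part `B_M = M ∩ W_i` (the cyclic quotient
`pr_W M ∕ B_M ≅ 𝒪∕π^k` of the design memo §1), with `B_M` itself `S`-stable into `M`.  Then **`S·M ⊆ M ⟺ (S − S_{ii})·pr(x₀) ∈ M`** — `S` acts on the cyclic quotient by the
scalar `λ̄(M) := ` the class of `S·pr(x₀)`, and `M` is stable iff `λ̄(M) ≡ S_{ii}`; for an elliptic `γ_W` this is «`k ≤ v`» exactly when the multiplier order of `B_M` contains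
`π^{−v}(λ − u)` (conductor `≤ N − v`), and in general depends on the branch. [cite: Kottwitz1986, §3] [cite: Rogawski1990, §4.9–§4.10 pp. 55–60] -/
theorem forall_mulVec_mem_iff_sub_smul_mulVec_proj_mem_of_generator {S : Matrix (Fin 3) (Fin 3) K} (i : Fin 3)
    (hcol : ∀ l, l ≠ i → S l i = 0) (hrow : ∀ l, l ≠ i → S i l = 0) (hu : Valued.v (S i i) ≤ 1)
    {M : Submodule 𝒪[K] (Fin 3 → K)} {x₀ : Fin 3 → K} (hx₀ : x₀ ∈ M)
    (hgen : ∀ x ∈ M, ∃ (c : K) (b : Fin 3 → K), Valued.v c ≤ 1 ∧ b ∈ M ∧ b i = 0 ∧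
      x - Pi.single i (x i) = c • (x₀ - Pi.single i (x₀ i)) + b)
    (hB : ∀ b ∈ M, b i = 0 → S *ᵥ b ∈ M) :
    (∀ x ∈ M, S *ᵥ x ∈ M) ↔ S *ᵥ (x₀ - Pi.single i (x₀ i)) - S i i • (x₀ - Pi.single i (x₀ i)) ∈ M := by
  constructor
  · intro hSM
    exact (sub_smul_mulVec_proj_mem_of_forall_mulVec_mem i hcol hrow hu hSM hx₀).1
  · intro h0 x hx
    refine mulVec_mem_of_forall_sub_smul_mulVec_proj_mem i hcol hu (fun x hx => ?_) hx
    obtain ⟨c, b, hc, hb, _hbi, hx'⟩ := hgen x hx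
    -- `(S − u)·pr(x) = c·(S − u)·pr(x₀) + (S b − u b)`
    have hre : S *ᵥ (x - Pi.single i (x i)) - S i i • (x - Pi.single i (x i)) =
        c • (S *ᵥ (x₀ - Pi.single i (x₀ i)) - S i i • (x₀ - Pi.single i (x₀ i))) + (S *ᵥ b - S i i • b) := by
      rw [hx', Matrix.mulVec_add, Matrix.mulVec_smul]
      module
    rw [hre]
    refine M.add_mem ?_ (M.sub_mem (hB b hb _hbi) (M.smul_mem (⟨S i i, (mem_integer_iff' _).2 hu⟩ : 𝒪[K]) hb))
    exact M.smul_mem (⟨c, (mem_integer_iff' _).2 hc⟩ : 𝒪[K]) h0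

end Literature.NumberTheory.Automorphic.UnitaryLatticeTree

end
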